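import Summits.HodgeConjecture.HodgeConjecture.Theorems.Ring2WeilCoverageNormClassEq
import Summits.HodgeConjecture.HodgeConjecture.Theorems.Ring2WeilNormObstructionDescentCensus
import HarnessLib

/-!
# Weil-type family coverage — product windows, part K: ×2 DATA FOR OTHER SEATS — habitat2's `C₆ × S₃` families on THE TARGET COMPONENT
# `R1 = W6.3.2 = (3, ℚ(√-3), [2])` (THEOREM K6), on `W4.3.2`, `W2.3.2`; ring2-b02's `GL₂(3) × L₃(2)` members of `W6.2.7` / `W4.2.7`
# (THEOREM X); and the `F₂₁ × PSL₃(3)` twelve-fold on `W12.7.13`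

research route conditional on HC_CM; not a corollary; Q11.4-sentence-2 already refuted in dim ≥ 3.

Ring 2, WEIL-TYPE FAMILY-COVERAGE CENSUS (`HOME/WEIL-FAMILY-COVERAGE.md` `## b04`, block b04.14 P.S. 3, owner ring2-b04, gen 50); eleventh part
of `Ring2WeilCoverageProductWindow` (same imports as part A).  This part holds LITERAL CLASSES only (engines `prodwin.py` — the Galois cover —
and `cosetwin.py` — the coset cover `C̃/(H₁ × Stab)` with its own polarisation; exact rational arithmetic; mirror `census-g50/`), each with its CELL
IDENTIFICATION, computed on THIS seat's engines for data first printed by OTHER seats: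
* §1 habitat2's THEOREM K6 (K6LAW-X2-B, 2026-08-23T17:53Z; the `k = 6` product-window law `[a_B] = [n]^{r₁}[2|H₂|]^m[2]^{m′}`, outside
  THEOREM S7's scope since `S_in(C₆) = {2}`): the `C₆ × S₃` data `(0; c5:3, c2:2, c5:2)` (genus 10, rigid; `(1,1)` surface, `det H = -8`:
  `W2.3.2`), `(0; c3:e, c1:3, c1:2, c1:2)` (genus 19, one parameter; `(2,2)` fourfold, `128/3`: `W4.3.2`) and **`(0; c3:e, c3:e, c5:3, c2:2, c5:2)`
  (genus 28, TWO parameters; `(3,3)` SIXFOLD, `det H = -26624/2187 = -2¹¹·13/3⁷`, `T = {2,3}`: `W6.3.2` = pub-hsemireg's TARGET COMPONENT R1)**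
  — all three `T = {2,3}` = K6's `T(3^{r₁}) Δ T(2^{m′})` with `m′ = 1` (the hidden-factor rank of the `C₃`-quotient datum, computed here too):
  CONCUR with habitat2 on a disjoint engine.
* §2 ring2-b02's `GL₂(3) × L₃(2)` members of `W6.2.7` (census b02.21, 2026-08-23T16:43Z; THEOREM X): rigid `(0; 2:22, 6:7A, 8a:42)` (genus 1417;
  `det H = -1/6804`), rigid `(0; 2:33, 3:33, 8a:42)` (genus 1513; `-1/504`) and the `W4.2.7` fourfold `(0; 2:42, 3:33, 8a:42)` (genus 1177; `41/1512`),
  complementing part J §3 (g 1321 rigid, g 2185 family): all `T = {2,7}`, class `[7]` = b02's classes — CONCUR.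
* §3 the `F₂₁ × PSL₃(3)` rigid curve `(0; 3a:3333, 3b:3333, 7a:632)` of genus 18253 (coset cover `C̃/(C₃ × Stab)`: 91 sheets, genus 13; exact
  admissibility: 943 488 generating triples): a `(6,6)` Weil-type TWELVE-FOLD with `det H = 16384/13 = 2¹⁴/13`, `T = {7,13}`: row
  `W12.7.13 = (6, ℚ(√-7), [13])` as THEOREM S7 predicts (`[13]^{r₁}`, `r₁ = 1`; `13` inert in `ℚ(√-7)`; ring2-b02's `thirteen_not_mem_norm_seven`).
* §4 the fold of gen 48's kit job j189825: the `PSL₂(𝔽₁₁)` `η`-piece of the rigid curve `(0; 3, 5b, 5b)` (genus 89) is a `(5,5)` tenfold of the SPLIT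
  class (`W10.11.1`) — THEOREM S4 (census b04.12 (C), Borel restriction) predicted SPLIT before the computation; 7/7 of the pre-registered
  `PSL₂(𝔽₁₁)` data now returned, all as predicted (engine `psl2x.py`, 24169 s on the farm; constructive norm witness by gen 48's `gen_lean_x.py`).

No `def`, no named fact, no `sorry`; nothing here is a statement about Hodge classes; `HC_CM` is used nowhere.
References: [cite: vanGeemen1994HodgeAV, (5.4.1), Lemma 5.2].
-/

set_option linter.dupNamespace false

open Literature.AlgebraicGeometry.Motives
open Literature.AlgebraicGeometry.VanGeemen1994
open Summit.HodgeConjecture.HodgeConjecture.Ring2.Hypotheses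

namespace Summit.HodgeConjecture.HodgeConjecture.Ring2.WeilCoverage

/-! ### §1 ×2 of habitat2's `C₆ × S₃` data (THEOREM K6): `W2.3.2`, `W4.3.2`, and the TARGET COMPONENT `W6.3.2` -/

/-- `C₆ × S₃` (habitat2 K6LAW-X2-B's window; ×2 here)-cover `(0; c5:3,c2:2,c5:2)` (genus 10, Hurwitz dimension 0; engine `prodwin.py`, exact): the HIDDEN FACTOR `B = V^{H₁×Stab(0)}` of the `(λ⊗ρ)`-piece `P` (`P ~ B^{2}`, census row of `P`: `W4.3.1`) — an abelian SURFACE with `(1,1)` `ℚ(√-3)`-action, WEIL TYPE — has literal `det H|_B = -8`, `a = 8`, `T(a) = [2, 3]`: row `W2.3.2` (NON-split); `r₁ = dim_K H¹(C̃/G₂)_λ = 1`. THEOREM S7 does NOT apply (`S_in(C₆) = {2}`); habitat2's THEOREM K6 (K6LAW-X2-B, 2026-08-23T17:53Z) predicts `T(a_B) = T(n^{r₁}) Δ T(2^{m′})` with `r₁ = 1`, `m′ = 1`: `[2, 3]` — CONFIRMED.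
research route conditional on HC_CM; not a corollary; Q11.4-sentence-2 already refuted in dim ≥ 3. [cite: vanGeemen1994HodgeAV, (5.4.1)] -/
theorem pwC6S3_c53_c22_c52_q0_g10_mk_detH_ne_split :
    (QuotientGroup.mk (Units.mk0 ((-8 : ℚ)) (by norm_num)) : weilNormResidueGroup 3) ≠
      splitDiscriminantClass 1 3 := by
  have e : Units.mk0 ((-8 : ℚ)) (by norm_num) = -(Units.mk0 (8 : ℚ) (by norm_num)) := Units.ext (by norm_num)
  rw [Ne, e, mk_neg_eq_splitDiscriminantClass_iff_of_odd (n := 1) (by decide)]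
  have h := mul_not_mem_normUnitsSubgroup (mem_normUnitsSubgroup_of_sq_add_mul_sq (d := 3) (a := (4 : ℚ)) (by norm_num) (2 : ℚ) (0 : ℚ) (by norm_num))
    Summit.HodgeConjecture.Ring2WeilNormDescent.two_not_mem_norm_three
  rw [mk0_mul_mk0] at h
  norm_num at h
  exact h

/-- The same datum, CELL IDENTIFICATION: `[det H|_B] = [-2]` in `ℚˣ/Nm(ℚ(√-3)ˣ)` — the census ROW KEY of `W2.3.2` (`a·2 = (16 : ℚ) = ((4 : ℚ))² + 3·((0 : ℚ))²`).
research route conditional on HC_CM; not a corollary; Q11.4-sentence-2 already refuted in dim ≥ 3. [cite: vanGeemen1994HodgeAV, Lemma 5.2 (3)] -/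
theorem pwC6S3_c53_c22_c52_q0_g10_mk_detH_eq_key :
    (QuotientGroup.mk (Units.mk0 (-((8 : ℚ))) (neg_ne_zero.2 (by norm_num))) : weilNormResidueGroup 3) =
      QuotientGroup.mk (Units.mk0 (-(2 : ℚ)) (neg_ne_zero.2 (by norm_num))) :=
  mk_neg_eq_mk_neg_of_mul_mem (by norm_num) (by norm_num)
    (mem_normUnitsSubgroup_of_sq_add_mul_sq _ (4 : ℚ) (0 : ℚ) (by norm_num))

/-- `C₆ × S₃` (habitat2 K6LAW-X2-B's window; ×2 here)-cover `(0; c3:e,c1:3,c1:2,c1:2)` (genus 19, Hurwitz dimension 1; engine `prodwin.py`, exact): the HIDDEN FACTOR `B = V^{H₁×Stab(0)}` of the `(λ⊗ρ)`-piece `P` (`P ~ B^{2}`, census row of `P`: `W8.3.1`) — an abelian FOURFOLD with `(2,2)` `ℚ(√-3)`-action, WEIL TYPE — has literal `det H|_B = 128/3`, `a = 128/3`, `T(a) = [2, 3]`: row `W4.3.2` (NON-split); `r₁ = dim_K H¹(C̃/G₂)_λ = 2`. THEOREM S7 does NOT apply (`S_in(C₆) = {2}`); habitat2's THEOREM K6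 (K6LAW-X2-B, 2026-08-23T17:53Z) predicts `T(a_B) = T(n^{r₁}) Δ T(2^{m′})` with `r₁ = 2`, `m′ = 1`: `[2, 3]` — CONFIRMED.
research route conditional on HC_CM; not a corollary; Q11.4-sentence-2 already refuted in dim ≥ 3. [cite: vanGeemen1994HodgeAV, (5.4.1)] -/
theorem pwC6S3_c3e_c13_c12_c12_q0_g19_mk_detH_ne_split :
    (QuotientGroup.mk (Units.mk0 (((128 : ℚ) / 3)) (by norm_num)) : weilNormResidueGroup 3) ≠
      splitDiscriminantClass 2 3 := by
  have e : Units.mk0 (((128 : ℚ) / 3)) (by norm_num) = Units.mk0 ((128 : ℚ) / 3) (by norm_num) := Units.ext (by norm_num)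
  rw [Ne, e, mk_eq_splitDiscriminantClass_iff_of_even (n := 2) (by decide)]
  have h := mul_not_mem_normUnitsSubgroup (mem_normUnitsSubgroup_of_sq_add_mul_sq (d := 3) (a := ((64 : ℚ) / 3)) (by norm_num) (0 : ℚ) ((8 : ℚ) / 3) (by norm_num))
    Summit.HodgeConjecture.Ring2WeilNormDescent.two_not_mem_norm_three
  rw [mk0_mul_mk0] at h
  norm_num at h
  exact h

/-- The same datum, CELL IDENTIFICATION: `[det H|_B] = [2]` in `ℚˣ/Nm(ℚ(√-3)ˣ)` — the census ROW KEY of `W4.3.2` (`a·2 = ((256 : ℚ) / 3) = ((0 : ℚ))² + 3·(((16 : ℚ) / 3))²`).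
research route conditional on HC_CM; not a corollary; Q11.4-sentence-2 already refuted in dim ≥ 3. [cite: vanGeemen1994HodgeAV, Lemma 5.2 (3)] -/
theorem pwC6S3_c3e_c13_c12_c12_q0_g19_mk_detH_eq_key :
    (QuotientGroup.mk (Units.mk0 (((128 : ℚ) / 3)) (by norm_num)) : weilNormResidueGroup 3) =
      QuotientGroup.mk (Units.mk0 (2 : ℚ) (by norm_num)) :=
  mk_eq_mk_of_mul_mem (by norm_num) (by norm_num)
    (mem_normUnitsSubgroup_of_sq_add_mul_sq _ (0 : ℚ) ((16 : ℚ) / 3) (by norm_num))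

/-- `C₆ × S₃` (habitat2 K6LAW-X2-B's window; ×2 here)-cover `(0; c3:e,c3:e,c5:3,c2:2,c5:2)` (genus 28, Hurwitz dimension 2; engine `prodwin.py`, exact): the HIDDEN FACTOR `B = V^{H₁×Stab(0)}` of the `(λ⊗ρ)`-piece `P` (`P ~ B^{2}`, census row of `P`: `W12.3.1`) — an abelian SIXFOLD with `(3,3)` `ℚ(√-3)`-action, WEIL TYPE — has literal `det H|_B = -26624/2187`, `a = 26624/2187`, `T(a) = [2, 3]`: row `W6.3.2` (NON-split); `r₁ = dim_K H¹(C̃/G₂)_λ = 3`. THEOREM S7 does NOT apply (`S_in(C₆) = {2}`); habitat2's THEOREM K6 (K6LAW-X2-B, 2026-08-23T17:53Z) predicts `T(a_B) = T(n^{r₁}) Δ T(2^{m′})` with `r₁ = 3`, `m′ = 1`: `[2, 3]` — CONFIRMED.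
research route conditional on HC_CM; not a corollary; Q11.4-sentence-2 already refuted in dim ≥ 3. [cite: vanGeemen1994HodgeAV, (5.4.1)] -/
theorem pwC6S3_c3e_c3e_c53_c22_c52_q0_g28_mk_detH_ne_split :
    (QuotientGroup.mk (Units.mk0 (((-26624 : ℚ) / 2187)) (by norm_num)) : weilNormResidueGroup 3) ≠
      splitDiscriminantClass 3 3 := by
  have e : Units.mk0 (((-26624 : ℚ) / 2187)) (by norm_num) = -(Units.mk0 ((26624 : ℚ) / 2187) (by norm_num)) := Units.ext (by norm_num)
  rw [Ne, e, mk_neg_eq_splitDiscriminantClass_iff_of_odd (n := 3) (by decide)]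
  have h := mul_not_mem_normUnitsSubgroup (mem_normUnitsSubgroup_of_sq_add_mul_sq (d := 3) (a := ((13312 : ℚ) / 2187)) (by norm_num) ((-16 : ℚ) / 27) ((112 : ℚ) / 81) (by norm_num))
    Summit.HodgeConjecture.Ring2WeilNormDescent.two_not_mem_norm_three
  rw [mk0_mul_mk0] at h
  norm_num at h
  exact h

/-- The same datum, CELL IDENTIFICATION: `[det H|_B] = [-2]` in `ℚˣ/Nm(ℚ(√-3)ˣ)` — the census ROW KEY of `W6.3.2` (`a·2 = ((53248 : ℚ) / 2187) = (((-32 : ℚ) / 27))² + 3·(((224 : ℚ) / 81))²`).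
research route conditional on HC_CM; not a corollary; Q11.4-sentence-2 already refuted in dim ≥ 3. [cite: vanGeemen1994HodgeAV, Lemma 5.2 (3)] -/
theorem pwC6S3_c3e_c3e_c53_c22_c52_q0_g28_mk_detH_eq_key :
    (QuotientGroup.mk (Units.mk0 (-(((26624 : ℚ) / 2187))) (neg_ne_zero.2 (by norm_num))) : weilNormResidueGroup 3) =
      QuotientGroup.mk (Units.mk0 (-(2 : ℚ)) (neg_ne_zero.2 (by norm_num))) :=
  mk_neg_eq_mk_neg_of_mul_mem (by norm_num) (by norm_num)
    (mem_normUnitsSubgroup_of_sq_add_mul_sq _ ((-32 : ℚ) / 27) ((224 : ℚ) / 81) (by norm_num))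


/-! ### §2 ×2 of ring2-b02's `GL₂(3) × L₃(2)` members of `W6.2.7` / `W4.2.7` (census b02.21, THEOREM X) -/

/-- `GL₂(3) × L₃(2)` (`GL₂(3)` the degree-2 carrier of `ℚ(√-2)`, `H₁` = a reflection; `L₃(2) = PSL₂(7)` on 7 points; ring2-b02 b02.21's window, ×2 here)-cover `(0; 2:22,6:7A,8a:42)` (genus 1417, Hurwitz dimension 0; engine `cosetwin.py` on the coset cover `C̃/(H₁ × Stab(0))`, 168 sheets, genus 29, its own polarisation, exact): the HIDDEN FACTOR `B = V^{H₁×Stab(0)}` of the `(λ⊗ρ)`-piece `P` — an abelian SIXFOLD with `(3,3)` `ℚ(√-2)`-action, WEIL TYPE — has literal `det H|_B = -1/6804`, `a = 1/6804`, `T(a) = [2, 7]`: row `W6.2.7` (NON-split); `r₁ = dim_K H¹(C̃/G₂)_λ = 1`. THEOREM S7 (carrier-free product-window law, census b04.14 (A)) predicts `T(a_B) = [2, 7]` from `r₁ = 1` (`[a_B] = [n]^{r₁}`, `n = 7`) — CONFIRMED.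
research route conditional on HC_CM; not a corollary; Q11.4-sentence-2 already refuted in dim ≥ 3. [cite: vanGeemen1994HodgeAV, (5.4.1)] -/
theorem pwGL23L27_222_67A_8a42_q0_g1417_mk_detH_ne_split :
    (QuotientGroup.mk (Units.mk0 (((-1 : ℚ) / 6804)) (by norm_num)) : weilNormResidueGroup 2) ≠
      splitDiscriminantClass 3 2 := by
  have e : Units.mk0 (((-1 : ℚ) / 6804)) (by norm_num) = -(Units.mk0 ((1 : ℚ) / 6804) (by norm_num)) := Units.ext (by norm_num)
  rw [Ne, e, mk_neg_eq_splitDiscriminantClass_iff_of_odd (n := 3) (by decide)]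
  have h := mul_not_mem_normUnitsSubgroup (mem_normUnitsSubgroup_of_sq_add_mul_sq (d := 2) (a := ((1 : ℚ) / 47628)) (by norm_num) ((1 : ℚ) / 378) ((1 : ℚ) / 378) (by norm_num))
    Summit.HodgeConjecture.Ring2WeilNormDescent.seven_not_mem_norm_two
  rw [mk0_mul_mk0] at h
  norm_num at h
  exact h

/-- The same datum, CELL IDENTIFICATION: `[det H|_B] = [-7]` in `ℚˣ/Nm(ℚ(√-2)ˣ)` — the census ROW KEY of `W6.2.7` (`a·7 = ((1 : ℚ) / 972) = (((1 : ℚ) / 54))² + 2·(((1 : ℚ) / 54))²`).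
research route conditional on HC_CM; not a corollary; Q11.4-sentence-2 already refuted in dim ≥ 3. [cite: vanGeemen1994HodgeAV, Lemma 5.2 (3)] -/
theorem pwGL23L27_222_67A_8a42_q0_g1417_mk_detH_eq_key :
    (QuotientGroup.mk (Units.mk0 (-(((1 : ℚ) / 6804))) (neg_ne_zero.2 (by norm_num))) : weilNormResidueGroup 2) =
      QuotientGroup.mk (Units.mk0 (-(7 : ℚ)) (neg_ne_zero.2 (by norm_num))) :=
  mk_neg_eq_mk_neg_of_mul_mem (by norm_num) (by norm_num)
    (mem_normUnitsSubgroup_of_sq_add_mul_sq _ ((1 : ℚ) / 54) ((1 : ℚ) / 54) (by norm_num))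

/-- `GL₂(3) × L₃(2)` (`GL₂(3)` the degree-2 carrier of `ℚ(√-2)`, `H₁` = a reflection; `L₃(2) = PSL₂(7)` on 7 points; ring2-b02 b02.21's window, ×2 here)-cover `(0; 2:33,3:33,8a:42)` (genus 1513, Hurwitz dimension 0; engine `cosetwin.py` on the coset cover `C̃/(H₁ × Stab(0))`, 168 sheets, genus 27, its own polarisation, exact): the HIDDEN FACTOR `B = V^{H₁×Stab(0)}` of the `(λ⊗ρ)`-piece `P` — an abelian SIXFOLD with `(3,3)` `ℚ(√-2)`-action, WEIL TYPE — has literal `det H|_B = -1/504`, `a = 1/504`, `T(a) = [2, 7]`: row `W6.2.7` (NON-split); `r₁ = dim_K H¹(C̃/G₂)_λ = 1`. THEOREM S7 (carrier-free product-window law, census b04.14 (A)) predicts `T(a_B) = [2, 7]` from `r₁ = 1` (`[a_B] = [n]^{r₁}`, `n = 7`) — CONFIRMED.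
research route conditional on HC_CM; not a corollary; Q11.4-sentence-2 already refuted in dim ≥ 3. [cite: vanGeemen1994HodgeAV, (5.4.1)] -/
theorem pwGL23L27_233_333_8a42_q0_g1513_mk_detH_ne_split :
    (QuotientGroup.mk (Units.mk0 (((-1 : ℚ) / 504)) (by norm_num)) : weilNormResidueGroup 2) ≠
      splitDiscriminantClass 3 2 := by
  have e : Units.mk0 (((-1 : ℚ) / 504)) (by norm_num) = -(Units.mk0 ((1 : ℚ) / 504) (by norm_num)) := Units.ext (by norm_num)
  rw [Ne, e, mk_neg_eq_splitDiscriminantClass_iff_of_odd (n := 3) (by decide)]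
  have h := mul_not_mem_normUnitsSubgroup (mem_normUnitsSubgroup_of_sq_add_mul_sq (d := 2) (a := ((1 : ℚ) / 3528)) (by norm_num) (0 : ℚ) ((1 : ℚ) / 84) (by norm_num))
    Summit.HodgeConjecture.Ring2WeilNormDescent.seven_not_mem_norm_two
  rw [mk0_mul_mk0] at h
  norm_num at h
  exact h

/-- The same datum, CELL IDENTIFICATION: `[det H|_B] = [-7]` in `ℚˣ/Nm(ℚ(√-2)ˣ)` — the census ROW KEY of `W6.2.7` (`a·7 = ((1 : ℚ) / 72) = ((0 : ℚ))² + 2·(((1 : ℚ) / 12))²`).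
research route conditional on HC_CM; not a corollary; Q11.4-sentence-2 already refuted in dim ≥ 3. [cite: vanGeemen1994HodgeAV, Lemma 5.2 (3)] -/
theorem pwGL23L27_233_333_8a42_q0_g1513_mk_detH_eq_key :
    (QuotientGroup.mk (Units.mk0 (-(((1 : ℚ) / 504))) (neg_ne_zero.2 (by norm_num))) : weilNormResidueGroup 2) =
      QuotientGroup.mk (Units.mk0 (-(7 : ℚ)) (neg_ne_zero.2 (by norm_num))) :=
  mk_neg_eq_mk_neg_of_mul_mem (by norm_num) (by norm_num)
    (mem_normUnitsSubgroup_of_sq_add_mul_sq _ (0 : ℚ) ((1 : ℚ) / 12) (by norm_num))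

/-- `GL₂(3) × L₃(2)` (`GL₂(3)` the degree-2 carrier of `ℚ(√-2)`, `H₁` = a reflection; `L₃(2) = PSL₂(7)` on 7 points; ring2-b02 b02.21's window, ×2 here)-cover `(0; 2:42,3:33,8a:42)` (genus 1177, Hurwitz dimension 0; engine `cosetwin.py` on the coset cover `C̃/(H₁ × Stab(0))`, 168 sheets, genus 16, its own polarisation, exact): the HIDDEN FACTOR `B = V^{H₁×Stab(0)}` of the `(λ⊗ρ)`-piece `P` — an abelian FOURFOLD with `(2,2)` `ℚ(√-2)`-action, WEIL TYPE — has literal `det H|_B = 41/1512`, `a = 41/1512`, `T(a) = [2, 7]`: row `W4.2.7` (NON-split); `r₁ = dim_K H¹(C̃/G₂)_λ = 1`. THEOREM S7 (carrier-free product-window law, census b04.14 (A)) predicts `T(a_B) = [2, 7]` from `r₁ = 1` (`[a_B] = [n]^{r₁}`, `n = 7`) — CONFIRMED.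
research route conditional on HC_CM; not a corollary; Q11.4-sentence-2 already refuted in dim ≥ 3. [cite: vanGeemen1994HodgeAV, (5.4.1)] -/
theorem pwGL23L27_242_333_8a42_q0_g1177_mk_detH_ne_split :
    (QuotientGroup.mk (Units.mk0 (((41 : ℚ) / 1512)) (by norm_num)) : weilNormResidueGroup 2) ≠
      splitDiscriminantClass 2 2 := by
  have e : Units.mk0 (((41 : ℚ) / 1512)) (by norm_num) = Units.mk0 ((41 : ℚ) / 1512) (by norm_num) := Units.ext (by norm_num)
  rw [Ne, e, mk_eq_splitDiscriminantClass_iff_of_even (n := 2) (by decide)]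
  have h := mul_not_mem_normUnitsSubgroup (mem_normUnitsSubgroup_of_sq_add_mul_sq (d := 2) (a := ((41 : ℚ) / 10584)) (by norm_num) ((-1 : ℚ) / 18) ((-5 : ℚ) / 252) (by norm_num))
    Summit.HodgeConjecture.Ring2WeilNormDescent.seven_not_mem_norm_two
  rw [mk0_mul_mk0] at h
  norm_num at h
  exact h

/-- The same datum, CELL IDENTIFICATION: `[det H|_B] = [7]` in `ℚˣ/Nm(ℚ(√-2)ˣ)` — the census ROW KEY of `W4.2.7` (`a·7 = ((41 : ℚ) / 216) = (((-7 : ℚ) / 18))² + 2·(((-5 : ℚ) / 36))²`).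
research route conditional on HC_CM; not a corollary; Q11.4-sentence-2 already refuted in dim ≥ 3. [cite: vanGeemen1994HodgeAV, Lemma 5.2 (3)] -/
theorem pwGL23L27_242_333_8a42_q0_g1177_mk_detH_eq_key :
    (QuotientGroup.mk (Units.mk0 (((41 : ℚ) / 1512)) (by norm_num)) : weilNormResidueGroup 2) =
      QuotientGroup.mk (Units.mk0 (7 : ℚ) (by norm_num)) :=
  mk_eq_mk_of_mul_mem (by norm_num) (by norm_num)
    (mem_normUnitsSubgroup_of_sq_add_mul_sq _ ((-7 : ℚ) / 18) ((-5 : ℚ) / 36) (by norm_num))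


/-! ### §3 The `F₂₁ × PSL₃(3)` twelve-fold on `W12.7.13 = (6, ℚ(√-7), [13])` (THEOREM S7: `[13]^{r₁}`, `r₁ = 1`) -/

/-- `F₂₁ × PSL₃(3)` (`F₂₁` the degree-3 carrier of `ℚ(√-7)`; `PSL₃(3)` on the 13 points of `PG(2,3)`)-cover `(0; 3a:3333,3b:3333,7a:632)` (genus 18253, Hurwitz dimension 0; engine `cosetwin.py` on the coset cover `C̃/(H₁ × Stab(0))`, 91 sheets, genus 13, its own polarisation, exact): the HIDDEN FACTOR `B = V^{H₁×Stab(0)}` of the `(λ⊗ρ)`-piece `P` — an abelian TWELVEFOLD with `(6,6)` `ℚ(√-7)`-action, WEIL TYPE — has literal `det H|_B = 16384/13`, `a = 16384/13`, `T(a) = [7, 13]`: row `W12.7.13` (NON-split); `r₁ = dim_K H¹(C̃/G₂)_λ = 1`. THEOREM S7 (carrier-free product-window law, census b04.14 (A)) predicts `T(a_B) = [7, 13]` from `r₁ = 1` (`[a_B] = [n]^{r₁}`, `n = 13`) — CONFIRMED.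
research route conditional on HC_CM; not a corollary; Q11.4-sentence-2 already refuted in dim ≥ 3. [cite: vanGeemen1994HodgeAV, (5.4.1)] -/
theorem pwF21L33_3a3333_3b3333_7a632_q0_g18253_mk_detH_ne_split :
    (QuotientGroup.mk (Units.mk0 (((16384 : ℚ) / 13)) (by norm_num)) : weilNormResidueGroup 7) ≠
      splitDiscriminantClass 6 7 := by
  have e : Units.mk0 (((16384 : ℚ) / 13)) (by norm_num) = Units.mk0 ((16384 : ℚ) / 13) (by norm_num) := Units.ext (by norm_num)
  rw [Ne, e, mk_eq_splitDiscriminantClass_iff_of_even (n := 6) (by decide)]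
  have h := mul_not_mem_normUnitsSubgroup (mem_normUnitsSubgroup_of_sq_add_mul_sq (d := 7) (a := ((16384 : ℚ) / 169)) (by norm_num) ((128 : ℚ) / 13) (0 : ℚ) (by norm_num))
    Summit.HodgeConjecture.Ring2WeilNormDescent.thirteen_not_mem_norm_seven
  rw [mk0_mul_mk0] at h
  norm_num at h
  exact h

/-- The same datum, CELL IDENTIFICATION: `[det H|_B] = [13]` in `ℚˣ/Nm(ℚ(√-7)ˣ)` — the census ROW KEY of `W12.7.13` (`a·13 = (16384 : ℚ) = ((128 : ℚ))² + 7·((0 : ℚ))²`).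
research route conditional on HC_CM; not a corollary; Q11.4-sentence-2 already refuted in dim ≥ 3. [cite: vanGeemen1994HodgeAV, Lemma 5.2 (3)] -/
theorem pwF21L33_3a3333_3b3333_7a632_q0_g18253_mk_detH_eq_key :
    (QuotientGroup.mk (Units.mk0 (((16384 : ℚ) / 13)) (by norm_num)) : weilNormResidueGroup 7) =
      QuotientGroup.mk (Units.mk0 (13 : ℚ) (by norm_num)) :=
  mk_eq_mk_of_mul_mem (by norm_num) (by norm_num)
    (mem_normUnitsSubgroup_of_sq_add_mul_sq _ (128 : ℚ) (0 : ℚ) (by norm_num))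


/-! ### §4 Fold of gen 48's kit job j189825 (`PSL₂(𝔽₁₁)` `(0; 3, 5b, 5b)`, genus 89): THEOREM S4 (census b04.12 (C)) predicted SPLIT — 7/7 now -/

/-- `PSL2(11)`-cover `(0; c3,c5b,c5b)` (genus 89, Hurwitz dimension 0; kit engine `psl2x.py`): the `(η₁ ⊕ η₂)`-piece has `m = 2`, `K`-signature `(5,5)` — WEIL TYPE — `dim P = 10`, `K = ℚ(√-11)` through the centre of the group algebra; literal `det H = -41775726285668269783573572674771875/27`, `a = (−1)ⁿ det H = 41775726285668269783573572674771875/27`: row `W10.11.1` (SPLIT) — as THEOREM S4 of census b04.12 (Borel restriction) PREDICTED before the computation.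
research route conditional on HC_CM; not a corollary; Q11.4-sentence-2 already refuted in dim ≥ 3. [cite: vanGeemen1994HodgeAV, (5.4.1)] -/
theorem tenfold_psl2_11_3x5bx5b_g89_q0_mk_detH_eq_split :
    (QuotientGroup.mk (Units.mk0 ((-41775726285668269783573572674771875 : ℚ) / 27) (by norm_num)) : weilNormResidueGroup 11) =
      splitDiscriminantClass 5 11 := by
  have e : Units.mk0 ((-41775726285668269783573572674771875 : ℚ) / 27) (by norm_num) = -(Units.mk0 ((41775726285668269783573572674771875 : ℚ) / 27) (by norm_num)) := Units.ext (by norm_num)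
  rw [e, mk_neg_eq_splitDiscriminantClass_iff_of_odd (n := 5) (by decide)]
  exact mem_normUnitsSubgroup_of_sq_add_mul_sq _ ((110401594299605675 : ℚ) / 9) ((-101416632504064900 : ℚ) / 9) (by norm_num)

/-- The same class stated positively: `a = 41775726285668269783573572674771875/27 = (110401594299605675/9)² + 11·(-101416632504064900/9)² ∈ Nm(ℚ(√-11)ˣ)`.
research route conditional on HC_CM; not a corollary; Q11.4-sentence-2 already refuted in dim ≥ 3. [cite: vanGeemen1994HodgeAV, (5.4.1)] -/
theorem tenfold_psl2_11_3x5bx5b_g89_q0_a_mem_norm :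
    Units.mk0 ((41775726285668269783573572674771875 : ℚ) / 27) (by norm_num) ∈ normUnitsSubgroup ℚ (weilField 11) :=
  mem_normUnitsSubgroup_of_sq_add_mul_sq _ ((110401594299605675 : ℚ) / 9) ((-101416632504064900 : ℚ) / 9) (by norm_num)

end Summit.HodgeConjecture.HodgeConjecture.Ring2.WeilCoverage
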